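import Summits.HodgeConjecture.CorCM.PairFlipSlotCoefficientCriterion
import Mathlib.LinearAlgebra.Dual.Lemmas
import HarnessLib

/-!
# The hypothesis-free additivity criterion: `Hg(∏ A_i) = ∏ Hg(A_i)` iff the type vectors satisfy no non-trivial
# common matrix-coefficient relation

COR-CM (cell `pub-hodgecm2`, binder seat `b16` gen 54, count-neutral claim STAB-CONJ, file F4 — independent of F1–F3;
abstract `G`-set level — the CM-field dress is F4b `CorCM/CommonCoefficientCMFields`; theorems only, no definition, no named
fact, no `sorry`).  NEW as stated, hence under `Summits/`.  HONEST FRAMING: finite-dimensional linear algebra about the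
Kubota–Dodson rank of a family of CM types and its reading on products of CM abelian varieties; `HC_CM` is neither used
nor asserted.

SETTING.  Slots `i ∈ I`, `G` acting on each `E_i` (`Hom(K_i, ℂ)`), CM types `Φ_i` for `ρ`, type vectors `u_i = 𝟙_{Φ_i} −
𝟙_{Φ̄_i}`, `U(Φ_i)` the span of the translates, `U(Σ) ≤ ⊕_i U(Φ_i)` the span of the JOINT translates; the family is
ADDITIVE (`ext_i U(Φ_i) ≤ U(Σ)` for all `i`; `rank(Σ) + |I| = Σ_i rank Φ_i + 1`; `Hg(∏ A_i) = ∏ Hg(A_i)`) iff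
`U(Σ) = ⊕_i U(Φ_i)`.  The tree decides additivity EXACTLY in two situations: the evaluation criterion
(`Literature/…/CMTypeRankEvaluationCriterion`: independence of the evaluation subspaces in every IRREDUCIBLE
representation) and, for an IRREDUCIBLE base slot, the matrix-coefficient criterion (`PairFlipSlotCoefficientCriterion`,
this seat gen 52: no `λ` with `Σ_y λ(y) u₁(g y) = u₀(g x₀)`).  This file removes every hypothesis: a linear functional on
`ℚ^{⊔ E_i}` is a family of coefficient vectors `(μ_i : E_i → ℚ)_i`, it kills `U(Σ)` iff `Σ_i Σ_x μ_i(x) u_i(g x) = 0` for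
all `g`, and it kills `⊕_i U(Φ_i)` iff each `Σ_x μ_i(x) u_i(g x) = 0`; since a subspace is the joint kernel of the
functionals vanishing on it (`Subspace.dualAnnihilator_dualCoannihilator_eq`), we get:

> **`forall_map_le_iff_forall_rel`** (any number of slots, no hypothesis).  The family is additive IFF every relation
> `Σ_i Σ_{x ∈ E_i} μ_i(x) · u_i(g x) = 0` (all `g ∈ G`) among the MATRIX COEFFICIENTS `g ↦ u_i(g x)` splits slot by slot:
> `Σ_x μ_i(x) u_i(g x) = 0` for every `i` and `g`.  Equivalently the matrix-coefficient spaces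
> `MC_i = span_ℚ {g ↦ u_i(g x) : x ∈ E_i}` are linearly independent subspaces of `ℚ^G`.
>
> **`forall_map_le_iff_not_exists_commonCoeff`** (two slots `I = {i₀, i₁}`, no hypothesis).  Additive IFF there are NO
> `μ : E_{i₀} → ℚ`, `λ : E_{i₁} → ℚ` with `Σ_x μ(x) u₀(g x) = Σ_y λ(y) u₁(g y)` for all `g` and `≢ 0`: the type vectors have
> NO COMMON NON-ZERO MATRIX COEFFICIENT.  (For an irreducible `U(Φ₀)` one may take `μ = δ_{x₀}` — gen 52; in general not.)

A finite linear system once `G` is replaced by its image in `∏ Sym(E_i)` — the kit-decidable test for ANY tuple of CM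
fields and types (reducible base modules, Galois fields, shared subfields, twins in one closure …).  Rank forms
`typeRank_sigmaType_add_card_eq_iff_forall_rel`, `…_iff_not_exists_commonCoeff`, nondegeneracy forms
`typeRank_sigmaType_eq_iff_forall_rel`, `…_iff_not_exists_commonCoeff`.  The CM-field / abelian-variety dress (ANY finite
family of CM fields, ANY types; `B• = D•` on all products of simple pairwise non-isogenous realisations IFF …) is F4b.

## References

* [Gordon1999HodgeAVSurvey] B. B. Gordon, *A survey of the Hodge conjecture for abelian varieties*, §3 Theorem (Imai,
  Murty) with proof, 7.4–7.7, 10.10.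
* [Mai1989] L. Mai, *Lower bounds for the ranks of CM types*, J. Number Theory 32 (1989), §2 Prop. 1 (proof).
* [Serre1977] J.-P. Serre, *Linear Representations of Finite Groups*, GTM 42, §2.2, §7.2.
* [Deligne1982HodgeCycles] P. Deligne, *Hodge cycles on abelian varieties*, LNM 900 (1982), I Ex. 3.7.
-/

set_option autoImplicit false

noncomputable section

open scoped BigOperators

universe u v

namespace Summit.HodgeConjecture.CorCM.CommonCoeff

open Literature.NumberTheory.ComplexMultiplication
open scoped Classical

variable {G : Type u} [Group G]

/-! ### §1 Abstract slots -/

section Abstract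

variable {I : Type v} {E : I → Type v} [∀ i, MulAction G (E i)] [DecidableEq I] [Fintype I] [∀ i, Fintype (E i)]
  {Φ : ∀ i, Set (E i)}

omit [DecidableEq I] [Fintype I] [∀ i, Fintype (E i)] in
/-- `u_g(Ψ)(x) = u_1(Ψ)(g x)`: the `±1`-vector of the translate by `g`, pointwise. [cite: Deligne1982HodgeCycles, I Ex. 3.7 (c)] -/
theorem antiVec_apply {i : I} (Ψ : Set (E i)) (g : G) (x : E i) : antiVec Ψ g x = antiVec Ψ (1 : G) (g • x) := by
  simp only [antiVec, ← translateInd_mul, one_mul]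

omit [Fintype I] in
/-- A linear functional on `ℚ^{⊔ E_i}` evaluated on a slot extension, expanded along the point masses of the slot:
`φ(ext_i a) = Σ_x a(x) φ(ext_i δ_x)`. [folklore] -/
theorem apply_slotExt_eq_sum (φ : Module.Dual ℚ ((Σ i, E i) → ℚ)) (i : I) (a : E i → ℚ) :
    φ (slotExt i a) = ∑ x, a x * φ (slotExt i fun y => if x = y then 1 else 0) := by
  conv_lhs => rw [pi_eq_sum_univ a]
  rw [map_sum, map_sum]
  refine Finset.sum_congr rfl fun x _ => ?_
  rw [map_smul, map_smul, smul_eq_mul]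

/-- A functional on `ℚ^{⊔ E_i}` evaluated on a joint `±1`-vector: `φ(u_g(Σ)) = Σ_i Σ_x u_i(g x) φ(ext_i δ_x)`.
[cite: Deligne1982HodgeCycles, I Ex. 3.7 (c)] -/
theorem apply_antiVec_sigmaType_eq_sum (φ : Module.Dual ℚ ((Σ i, E i) → ℚ)) (Φ : ∀ i, Set (E i)) (g : G) :
    φ (antiVec (sigmaType Φ) g) =
      ∑ i, ∑ x, antiVec (Φ i) (1 : G) (g • x) * φ (slotExt i fun y => if x = y then 1 else 0) := by
  rw [antiVec_sigmaType_eq_sigmaLift, sigmaLift_eq_sum_slotExt, map_sum]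
  refine Finset.sum_congr rfl fun i _ => ?_
  rw [apply_slotExt_eq_sum]
  refine Finset.sum_congr rfl fun x _ => ?_
  rw [antiVec_apply (Φ i) g x]

/-- The functional with coefficient family `μ`: `f ↦ Σ_i Σ_x μ_i(x) f(i, x)`, evaluated on a slot extension.
[folklore] -/
theorem sum_sum_mul_slotExt (μ : ∀ i, E i → ℚ) (i : I) (a : E i → ℚ) :
    ∑ j, ∑ x, μ j x * slotExt i a ⟨j, x⟩ = ∑ x, μ i x * a x := by
  rw [Finset.sum_eq_single i (fun j _ hji => Finset.sum_eq_zero fun x _ => by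
      rw [slotExt_apply_of_ne hji, mul_zero]) (fun hi => (hi (Finset.mem_univ i)).elim)]
  refine Finset.sum_congr rfl fun x _ => ?_
  rw [slotExt_apply_same]

/-- **THE HYPOTHESIS-FREE CRITERION (any number of slots).**  The family is additive (`ext_i U(Φ_i) ≤ U(Σ)` for all
`i`) IFF every relation `Σ_i Σ_x μ_i(x) u_i(g x) = 0` (all `g ∈ G`) among the matrix coefficients splits slot by slot.
No hypothesis on `G`, the slots or the types. [cite: Gordon1999HodgeAVSurvey, §3 Theorem (proof) and 7.7]
[cite: Mai1989, §2 Prop. 1 (proof)] -/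
theorem forall_map_le_iff_forall_rel (Φ : ∀ i, Set (E i)) :
    (∀ i, (antiSpan G (Φ i)).map (slotExt i) ≤ antiSpan G (sigmaType Φ)) ↔
      ∀ μ : ∀ i, E i → ℚ, (∀ g : G, ∑ i, ∑ x, μ i x * antiVec (Φ i) (1 : G) (g • x) = 0) →
        ∀ (i : I) (g : G), ∑ x, μ i x * antiVec (Φ i) (1 : G) (g • x) = 0 := by
  constructor
  · intro hadd μ hμ i g
    -- the functional `f ↦ Σ_j Σ_x μ_j(x) f(j, x)` kills `U(Σ)`, hence `ext_i u_g(Φ_i)`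
    let ℓ : ((Σ j, E j) → ℚ) →ₗ[ℚ] ℚ :=
      { toFun := fun f => ∑ j, ∑ x, μ j x * f ⟨j, x⟩
        map_add' := fun f f' => by
          simp only [Pi.add_apply, mul_add, Finset.sum_add_distrib]
        map_smul' := fun c f => by
          simp only [Pi.smul_apply, smul_eq_mul, RingHom.id_apply, Finset.mul_sum, mul_left_comm] }
    have hℓ : ∀ f, ℓ f = ∑ j, ∑ x, μ j x * f ⟨j, x⟩ := fun f => rfl
    have hker : antiSpan G (sigmaType Φ) ≤ LinearMap.ker ℓ := by
      refine Submodule.span_le.2 ?_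
      rintro _ ⟨k, rfl⟩
      rw [SetLike.mem_coe, LinearMap.mem_ker, hℓ]
      refine Eq.trans (Finset.sum_congr rfl fun j _ => Finset.sum_congr rfl fun x _ => ?_) (hμ k)
      show μ j x * antiVec (sigmaType Φ) k ⟨j, x⟩ = _
      rw [antiVec_sigmaType, antiVec_apply (Φ j) k x]
    have hmem : slotExt i (antiVec (Φ i) g) ∈ LinearMap.ker ℓ :=
      hker (hadd i ⟨antiVec (Φ i) g, Submodule.subset_span ⟨g, rfl⟩, rfl⟩)
    rw [LinearMap.mem_ker, hℓ, sum_sum_mul_slotExt] at hmem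
    rw [← hmem]
    exact Finset.sum_congr rfl fun x _ => by rw [antiVec_apply (Φ i) g x]
  · intro hrel i
    rw [antiSpan, Submodule.map_span_le]
    rintro _ ⟨g, rfl⟩
    -- a vector lies in `U(Σ)` iff every functional killing `U(Σ)` kills it
    rw [← Subspace.dualAnnihilator_dualCoannihilator_eq (W := antiSpan G (sigmaType Φ)),
      Submodule.mem_dualCoannihilator]
    intro φ hφ
    rw [Submodule.mem_dualAnnihilator] at hφ
    let μ : ∀ j, E j → ℚ := fun j x => φ (slotExt j fun y => if x = y then 1 else 0)
    have hμ : ∀ k : G, ∑ j, ∑ x, μ j x * antiVec (Φ j) (1 : G) (k • x) = 0 := by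
      intro k
      have h0 := hφ _ (Submodule.subset_span ⟨k, rfl⟩ : antiVec (sigmaType Φ) k ∈ antiSpan G (sigmaType Φ))
      rw [apply_antiVec_sigmaType_eq_sum] at h0
      refine Eq.trans (Finset.sum_congr rfl fun j _ => Finset.sum_congr rfl fun x _ => ?_) h0
      exact mul_comm _ _
    have h1 := hrel μ hμ i g
    refine Eq.trans ?_ h1
    rw [apply_slotExt_eq_sum]
    refine Finset.sum_congr rfl fun x _ => ?_
    show antiVec (Φ i) g x * φ (slotExt i fun y => if x = y then 1 else 0) = μ i x * antiVec (Φ i) (1 : G) (g • x)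
    rw [antiVec_apply (Φ i) g x]
    exact mul_comm _ _

variable {ρ : G} [Nonempty I] [∀ i, Nonempty (E i)]

/-- **Rank form**: `rank(Σ) + |I| = Σ_i rank(Φ_i) + 1` IFF every matrix-coefficient relation splits slot by slot.
[cite: Gordon1999HodgeAVSurvey, §3 Theorem (1) and 7.7] -/
theorem typeRank_sigmaType_add_card_eq_iff_forall_rel (h : ∀ i, IsCMTypeWith ρ (Φ i)) :
    typeRank G (sigmaType Φ) + Fintype.card I = (∑ i, typeRank G (Φ i)) + 1 ↔
      ∀ μ : ∀ i, E i → ℚ, (∀ g : G, ∑ i, ∑ x, μ i x * antiVec (Φ i) (1 : G) (g • x) = 0) →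
        ∀ (i : I) (g : G), ∑ x, μ i x * antiVec (Φ i) (1 : G) (g • x) = 0 := by
  rw [← forall_map_slotExt_le_iff_typeRank_sigmaType_add_card_eq h]
  exact forall_map_le_iff_forall_rel Φ

/-- **Nondegeneracy form**: `Σ` is nondegenerate IFF every member is nondegenerate and every matrix-coefficient
relation splits slot by slot. [cite: Gordon1999HodgeAVSurvey, 7.5–7.7] -/
theorem typeRank_sigmaType_eq_iff_forall_rel (h : ∀ i, IsCMTypeWith ρ (Φ i)) :
    typeRank G (sigmaType Φ) = Fintype.card (Σ i, E i) / 2 + 1 ↔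
      (∀ i, typeRank G (Φ i) = Fintype.card (E i) / 2 + 1) ∧
        ∀ μ : ∀ i, E i → ℚ, (∀ g : G, ∑ i, ∑ x, μ i x * antiVec (Φ i) (1 : G) (g • x) = 0) →
          ∀ (i : I) (g : G), ∑ x, μ i x * antiVec (Φ i) (1 : G) (g • x) = 0 := by
  constructor
  · intro hnd
    exact ⟨typeRank_eq_of_typeRank_sigmaType_eq h hnd,
      (forall_map_le_iff_forall_rel Φ).1 (forall_map_slotExt_le_of_typeRank_sigmaType_eq h hnd)⟩
  · rintro ⟨hnd, hrel⟩
    exact (forall_map_slotExt_le_iff_typeRank_sigmaType_eq h hnd).1 ((forall_map_le_iff_forall_rel Φ).2 hrel)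

end Abstract

/-! ### Two slots: no common non-zero matrix coefficient -/

section Two

variable {I : Type v} {E : I → Type v} [∀ i, MulAction G (E i)] [DecidableEq I] [Fintype I] [∀ i, Fintype (E i)]
  {Φ : ∀ i, Set (E i)} {i₀ i₁ : I}

/-- **THE HYPOTHESIS-FREE CRITERION (two slots).**  `I = {i₀, i₁}`: the pair is additive IFF there are NO coefficient
vectors `μ : E_{i₀} → ℚ`, `λ : E_{i₁} → ℚ` with `Σ_x μ(x) u₀(g x) = Σ_y λ(y) u₁(g y)` for all `g ∈ G` and some value
non-zero — the type vectors have no common non-zero matrix coefficient.  No hypothesis on `G`, the slots or the types.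
[cite: Gordon1999HodgeAVSurvey, §3 Theorem (proof) and 7.5–7.7] [cite: Serre1977, §7.2] -/
theorem forall_map_le_iff_not_exists_commonCoeff (hI : ∀ j, j = i₀ ∨ j = i₁) (h01 : i₀ ≠ i₁) :
    (∀ i, (antiSpan G (Φ i)).map (slotExt i) ≤ antiSpan G (sigmaType Φ)) ↔
      ¬ ∃ (μ : E i₀ → ℚ) (lam : E i₁ → ℚ),
        (∀ g : G, ∑ x, μ x * antiVec (Φ i₀) (1 : G) (g • x) = ∑ y, lam y * antiVec (Φ i₁) (1 : G) (g • y)) ∧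
          ∃ g : G, ∑ x, μ x * antiVec (Φ i₀) (1 : G) (g • x) ≠ 0 := by
  constructor
  · rintro hadd ⟨μ, lam, hrel, g, hg⟩
    -- the functional `f ↦ Σ_x μ(x) f(i₀, x) − Σ_y λ(y) f(i₁, y)` kills `U(Σ)`, hence `ext_{i₀} u_g(Φ₀)`
    let ℓ : ((Σ j, E j) → ℚ) →ₗ[ℚ] ℚ :=
      { toFun := fun f => ∑ x, μ x * f ⟨i₀, x⟩ - ∑ y, lam y * f ⟨i₁, y⟩
        map_add' := fun f f' => by
          simp only [Pi.add_apply, mul_add, Finset.sum_add_distrib]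
          ring
        map_smul' := fun c f => by
          simp only [Pi.smul_apply, smul_eq_mul, RingHom.id_apply, Finset.mul_sum, mul_left_comm, mul_sub] }
    have hℓ : ∀ f, ℓ f = ∑ x, μ x * f ⟨i₀, x⟩ - ∑ y, lam y * f ⟨i₁, y⟩ := fun f => rfl
    have hker : antiSpan G (sigmaType Φ) ≤ LinearMap.ker ℓ := by
      refine Submodule.span_le.2 ?_
      rintro _ ⟨k, rfl⟩
      rw [SetLike.mem_coe, LinearMap.mem_ker, hℓ, sub_eq_zero]
      have e₀ : ∀ x : E i₀, antiVec (sigmaType Φ) k ⟨i₀, x⟩ = antiVec (Φ i₀) (1 : G) (k • x) := fun x => by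
        rw [antiVec_sigmaType]; exact antiVec_apply (Φ i₀) k x
      have e₁ : ∀ y : E i₁, antiVec (sigmaType Φ) k ⟨i₁, y⟩ = antiVec (Φ i₁) (1 : G) (k • y) := fun y => by
        rw [antiVec_sigmaType]; exact antiVec_apply (Φ i₁) k y
      show ∑ x, μ x * antiVec (sigmaType Φ) k ⟨i₀, x⟩ = ∑ y, lam y * antiVec (sigmaType Φ) k ⟨i₁, y⟩
      simp only [e₀, e₁]
      exact hrel k
    have hmem : slotExt i₀ (antiVec (Φ i₀) g) ∈ LinearMap.ker ℓ :=
      hker (hadd i₀ ⟨antiVec (Φ i₀) g, Submodule.subset_span ⟨g, rfl⟩, rfl⟩)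
    rw [LinearMap.mem_ker, hℓ] at hmem
    simp only [slotExt_apply_same, slotExt_apply_of_ne (Ne.symm h01), mul_zero, Finset.sum_const_zero,
      sub_zero] at hmem
    apply hg
    rw [← hmem]
    exact Finset.sum_congr rfl fun x _ => by rw [antiVec_apply (Φ i₀) g x]
  · intro hnot
    rw [forall_map_le_iff_forall_rel]
    intro μ hμ
    -- the two-slot relation says: the `i₀`- and `i₁`-coefficients have equal-and-opposite matrix coefficients
    have hsplit : ∀ (f : ∀ i, G → ℚ) (g : G), ∑ i, f i g = f i₀ g + f i₁ g := by
      intro f g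
      have huniv : (Finset.univ : Finset I) = {i₀, i₁} := by
        ext j
        simp only [Finset.mem_univ, Finset.mem_insert, Finset.mem_singleton, true_iff]
        exact hI j
      rw [huniv, Finset.sum_pair h01]
    have hrel : ∀ g : G, ∑ x, μ i₀ x * antiVec (Φ i₀) (1 : G) (g • x) =
        ∑ y, (-μ i₁ y) * antiVec (Φ i₁) (1 : G) (g • y) := by
      intro g
      have h0 := hμ g
      rw [hsplit (fun i g => ∑ x, μ i x * antiVec (Φ i) (1 : G) (g • x)) g] at h0
      simp only [neg_mul, Finset.sum_neg_distrib]
      linarith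
    -- so both vanish, by `hnot`
    have h0 : ∀ g : G, ∑ x, μ i₀ x * antiVec (Φ i₀) (1 : G) (g • x) = 0 := by
      by_contra hne
      obtain ⟨g, hg⟩ := not_forall.1 hne
      exact hnot ⟨μ i₀, fun y => -μ i₁ y, hrel, g, hg⟩
    have h1 : ∀ g : G, ∑ y, μ i₁ y * antiVec (Φ i₁) (1 : G) (g • y) = 0 := by
      intro g
      have := hrel g
      rw [h0 g] at this
      simp only [neg_mul, Finset.sum_neg_distrib] at this
      linarith
    intro i g
    rcases hI i with rfl | rfl
    · exact h0 g
    · exact h1 g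

variable {ρ : G} [Nonempty I] [∀ i, Nonempty (E i)]

/-- **Rank form (two slots)**: `rank(Φ₀, Φ₁) + 2 = rank Φ₀ + rank Φ₁ + 1` IFF no common non-zero matrix coefficient.
[cite: Gordon1999HodgeAVSurvey, §3 Theorem (1) and 7.5–7.7] -/
theorem typeRank_sigmaType_add_card_eq_iff_not_exists_commonCoeff (h : ∀ i, IsCMTypeWith ρ (Φ i))
    (hI : ∀ j, j = i₀ ∨ j = i₁) (h01 : i₀ ≠ i₁) :
    typeRank G (sigmaType Φ) + Fintype.card I = (∑ i, typeRank G (Φ i)) + 1 ↔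
      ¬ ∃ (μ : E i₀ → ℚ) (lam : E i₁ → ℚ),
        (∀ g : G, ∑ x, μ x * antiVec (Φ i₀) (1 : G) (g • x) = ∑ y, lam y * antiVec (Φ i₁) (1 : G) (g • y)) ∧
          ∃ g : G, ∑ x, μ x * antiVec (Φ i₀) (1 : G) (g • x) ≠ 0 := by
  rw [← forall_map_slotExt_le_iff_typeRank_sigmaType_add_card_eq h]
  exact forall_map_le_iff_not_exists_commonCoeff hI h01

/-- **Nondegeneracy form (two slots)**: `(Φ₀, Φ₁)` is nondegenerate IFF both are nondegenerate and the type vectors have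
no common non-zero matrix coefficient. [cite: Gordon1999HodgeAVSurvey, 7.5–7.7] -/
theorem typeRank_sigmaType_eq_iff_not_exists_commonCoeff (h : ∀ i, IsCMTypeWith ρ (Φ i))
    (hI : ∀ j, j = i₀ ∨ j = i₁) (h01 : i₀ ≠ i₁) :
    typeRank G (sigmaType Φ) = Fintype.card (Σ i, E i) / 2 + 1 ↔
      typeRank G (Φ i₀) = Fintype.card (E i₀) / 2 + 1 ∧ typeRank G (Φ i₁) = Fintype.card (E i₁) / 2 + 1 ∧
        ¬ ∃ (μ : E i₀ → ℚ) (lam : E i₁ → ℚ),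
          (∀ g : G, ∑ x, μ x * antiVec (Φ i₀) (1 : G) (g • x) = ∑ y, lam y * antiVec (Φ i₁) (1 : G) (g • y)) ∧
            ∃ g : G, ∑ x, μ x * antiVec (Φ i₀) (1 : G) (g • x) ≠ 0 := by
  constructor
  · intro hnd
    exact ⟨typeRank_eq_of_typeRank_sigmaType_eq h hnd i₀, typeRank_eq_of_typeRank_sigmaType_eq h hnd i₁,
      (forall_map_le_iff_not_exists_commonCoeff hI h01).1 (forall_map_slotExt_le_of_typeRank_sigmaType_eq h hnd)⟩
  · rintro ⟨hnd₀, hnd₁, hnot⟩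
    refine (forall_map_slotExt_le_iff_typeRank_sigmaType_eq h fun i => ?_).1
      ((forall_map_le_iff_not_exists_commonCoeff hI h01).2 hnot)
    rcases hI i with rfl | rfl
    · exact hnd₀
    · exact hnd₁

end Two

end Summit.HodgeConjecture.CorCM.CommonCoeff

end
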